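import Summits.QuantumFields.YangMills.Theorems.LuscherReductionRunningReductionCoarseUpperCopies
import HarnessLib

/-!
# ★★ THE ONE-SITE INNER NO-INTRUDER `InnerNoIntruderOneOrbitAt 1 δ` — from crux ONE by Courant–Fischer and the eight-copies calculus
# (lane A of S-BASE, crux `TwistedTraceScaling` stmt-QuantumFields-20203, C4 INNER: the spectral input of the SLOW clause of the Born–Oppenheimer package;
# design note `pub/ym-fleet/ym-luscher-20007-p1/COARSE-DESIGN.md` §24)

The SLOW clause of `SoftTubeBOPackageAt` compares the slow block of the gauge-averaged kernel with the ONE-SITE levels `levelValue su2Rep 1 (L³β) k`.  After the colour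
average (cdisprove R32: the slow factor of `K̃_β` is the `Ad`-averaged one-site kernel, so the slow test functions are WLOG `Ad`-invariant) its spectral input is exactly the
one-orbit inner statement AT ONE SITE: every `(k+1)`-parameter family of bounded measurable GAUGE-invariant (= `Ad`-invariant) one-site functions supported in
`{orbitDist < δ}` (NOT twist-invariant) has a nonzero combination with Rayleigh quotient `≤ e^{ελ_b}·μ_k`.  THIS FILE proves it from the tree:
* `exists_coeff_orthogonal` — rank–nullity on coefficients: `k+1` physical functions have a nonzero combination orthogonal to any `k` physical constraints;
* `exists_coeff_rayleigh_lt_of_levelValue_lt` — **the upper Courant–Fischer door**: if `λ_k(β, L) < s` then every such family `F₀…F_k` with `‖F_a‖² > 0` (`a ≠ 0`) has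
  `a ≠ 0` with `⟨F_a, K_β F_a⟩ < s‖F_a‖²` (straight from the `sInf`/`sSup` definition of `levelValue`; any `L`);
* ★★ `innerNoIntruderOneOrbitAt_one` — `InnerNoIntruderOneOrbitAt 1 δ` for every scale `δ` eventually `≤ 1/2`: twist-symmetrise the family (`twistSum`, physical),
  apply the door at `s = e^{ελ_b/2}μ_k > μ_k = λ_k(β,1)` (ONE: `μ_k > 0`), and undo the eight copies (`l2_twistSum`, `abs_qform_twistSum_sub_le`, `crossBound_eventually_small`).
HONEST FRAMING: a one-site (finite-dimensional semiclassics) statement, consequence of the PROVED crux ONE; it is the SLOW input of C4, not C4; not a gap, not Clay.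
-/

set_option autoImplicit false

noncomputable section

open MeasureTheory Filter Topology Real
open scoped BigOperators
open Literature.MathematicalPhysics.QuantumFieldTheory
open Literature.MathematicalPhysics.QuantumLattice

namespace Summit.QuantumFields.YangMills.Theorems.FemtoTransferGap

variable {L : ℕ} [NeZero L]

/-! ## §1 Coefficient linear algebra and the upper Courant–Fischer door (any `L`) -/

/-- Rank–nullity on coefficients: `k+1` physical functions have a NONZERO combination `L²`-orthogonal to any `k` physical constraint functions. [cite: ReedSimonIV1978, Thm. XIII.1] -/
theorem exists_coeff_orthogonal {k : ℕ} (F : Fin (k + 1) → GaugeConfig 3 L SU2 → ℝ) (hF : ∀ i, IsPhys (F i))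
    (φs : Fin k → GaugeConfig 3 L SU2 → ℝ) (hφ : ∀ j, IsPhys (φs j)) :
    ∃ a : Fin (k + 1) → ℝ, a ≠ 0 ∧ ∀ j, l2 (fun U => ∑ i, a i * F i U) (φs j) = 0 := by
  let Φ : (Fin (k + 1) → ℝ) →ₗ[ℝ] (Fin k → ℝ) :=
    { toFun := fun a j => ∑ i, a i * l2 (F i) (φs j)
      map_add' := fun a b => by funext j; simp only [Pi.add_apply, add_mul, Finset.sum_add_distrib]
      map_smul' := fun c a => by funext j; simp only [Pi.smul_apply, smul_eq_mul, RingHom.id_apply, Finset.mul_sum, mul_assoc] }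
  have hlt : Module.finrank ℝ (Fin k → ℝ) < Module.finrank ℝ (Fin (k + 1) → ℝ) := by simp
  have hker : LinearMap.ker Φ ≠ ⊥ := LinearMap.ker_ne_bot_of_finrank_lt hlt
  obtain ⟨a, ha, hne⟩ := (Submodule.ne_bot_iff _).mp hker
  refine ⟨a, hne, fun j => ?_⟩
  have h := congr_fun (LinearMap.mem_ker.mp ha) j
  rw [l2_sum_mul_left_lat Finset.univ F hF a (hφ j)]
  exact h

/-- **The upper Courant–Fischer door**: if `λ_k(β, L) < s` then every family `F₀ … F_k` of physical functions whose nonzero combinations have positive norm has a nonzero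
combination with `⟨F_a, K_β F_a⟩ < s·‖F_a‖²`. [cite: ReedSimonIV1978, Thm. XIII.1] -/
theorem exists_coeff_rayleigh_lt_of_levelValue_lt {β s : ℝ} {k : ℕ} (hs : levelValue su2Rep L β k < s)
    (F : Fin (k + 1) → GaugeConfig 3 L SU2 → ℝ) (hF : ∀ i, IsPhys (F i))
    (hpos : ∀ a : Fin (k + 1) → ℝ, a ≠ 0 → 0 < l2 (fun U => ∑ i, a i * F i U) (fun U => ∑ i, a i * F i U)) :
    ∃ a : Fin (k + 1) → ℝ, a ≠ 0 ∧
      qform su2Rep β (fun U => ∑ i, a i * F i U) (fun U => ∑ i, a i * F i U) < s * l2 (fun U => ∑ i, a i * F i U) (fun U => ∑ i, a i * F i U) := by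
  unfold levelValue at hs
  have hne : {t : ℝ | ∃ φs : Fin k → (GaugeConfig 3 L SU2 → ℝ), (∀ i, IsPhys (φs i)) ∧
      t = sSup (rayleighSet su2Rep L β fun ψ => ∀ i, l2 ψ (φs i) = 0)}.Nonempty := ⟨_, fun _ _ => 1, fun _ => isPhys_const 1, rfl⟩
  obtain ⟨t, ⟨φs, hφs, rfl⟩, hts⟩ := exists_lt_of_csInf_lt hne hs
  obtain ⟨a, ha, horth⟩ := exists_coeff_orthogonal F hF φs hφs
  refine ⟨a, ha, ?_⟩
  have hp := hpos a ha
  have hmem : qform su2Rep β (fun U => ∑ i, a i * F i U) (fun U => ∑ i, a i * F i U) / l2 (fun U => ∑ i, a i * F i U) (fun U => ∑ i, a i * F i U) ∈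
      rayleighSet su2Rep L β (fun ψ => ∀ i, l2 ψ (φs i) = 0) :=
    ⟨_, isPhys_sum_mul_lat Finset.univ F hF a, horth, hp, rfl⟩
  have hle := le_csSup (bddAbove_rayleighSet_su2Rep L β _) hmem
  have hlt' : qform su2Rep β (fun U => ∑ i, a i * F i U) (fun U => ∑ i, a i * F i U) / l2 (fun U => ∑ i, a i * F i U) (fun U => ∑ i, a i * F i U) < s :=
    lt_of_le_of_lt hle hts
  rwa [div_lt_iff₀ hp] at hlt'

/-! ## §2 The endgame and ★★ the one-site inner no-intruder -/

/-- Pure-real endgame: from `q_F < e^{ε lam/2} μk · n_F`, `q_F ≥ 8 q_G − 56 cB n_G`, `n_F = 8 n_G`, `28 cB ≤ ε lam μ₀`, `μ₀/2 ≤ μk` conclude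
`q_G μ₀ ≤ e^{ε lam} μk μ₀ n_G`. [folklore] -/
theorem oneSite_inner_endgame {qF qG nG μ0 μk cB lam ε : ℝ} (hnG : 0 ≤ nG) (hμ0 : 0 ≤ μ0) (hlam : 0 ≤ lam) (hε : 0 ≤ ε)
    (hμk2 : μ0 / 2 ≤ μk) (hq : 8 * qG - 56 * (cB * nG) ≤ qF) (hF : qF ≤ Real.exp (ε / 2 * lam) * μk * (8 * nG))
    (hsc : 28 * cB ≤ ε * lam * μ0) :
    qG * μ0 ≤ Real.exp (ε * lam) * μk * μ0 * nG := by
  have hgap := half_le_exp_sub_exp_half (t := ε * lam) (by positivity)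
  have e1 : ε * lam / 2 = ε / 2 * lam := by ring
  rw [e1] at hgap
  have hμk0 : 0 ≤ μk := by linarith
  -- `qG ≤ e^{ε lam/2} μk nG + 7 cB nG`
  have h1 : qG ≤ Real.exp (ε / 2 * lam) * μk * nG + 7 * (cB * nG) := by linarith
  -- `7 cB μ₀ ≤ (ε lam/4) μ₀² …`: multiply by `μ₀` and use `28 cB ≤ ε lam μ₀`, `μ₀/2 ≤ μk`, `ε lam/2 ≤ e^{ε lam} − e^{ε lam/2}`
  have h2 : 7 * (cB * nG) * μ0 ≤ (Real.exp (ε * lam) - Real.exp (ε / 2 * lam)) * μk * μ0 * nG := by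
    have h3 : 7 * cB ≤ ε * lam * μ0 / 4 := by linarith
    have h4 : ε * lam * μ0 / 4 ≤ (Real.exp (ε * lam) - Real.exp (ε / 2 * lam)) * μk := by
      have h0 : 0 ≤ ε / 2 * lam := by positivity
      have hD : 0 ≤ Real.exp (ε * lam) - Real.exp (ε / 2 * lam) := le_trans h0 hgap
      have := mul_le_mul hgap hμk2 (by positivity) hD
      linarith
    have h5 := mul_le_mul_of_nonneg_right (h3.trans h4) (mul_nonneg hμ0 hnG)
    nlinarith [h5]
  have h6 := mul_le_mul_of_nonneg_right h1 hμ0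
  nlinarith [h6, h2]

/-- ★★ **THE ONE-SITE INNER NO-INTRUDER**: `InnerNoIntruderOneOrbitAt 1 δ` for every scale `δ` with `δ β ≤ 1/2` eventually — every `(k+1)`-family of bounded measurable
gauge-invariant one-site functions supported in `{orbitDist < δ β}` with nondegenerate Gram matrix has a nonzero combination `ψ` with
`⟨ψ, K_βψ⟩·μ₀(1³β) ≤ e^{ελ_b(1³β)}·μ_k(1³β)·λ₀(β,1)·‖ψ‖²`.  Proof: `twistSum` makes the family physical with `‖·‖² × 8` and form `× 8` up to `56·crossBound·‖·‖²`; the upper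
Courant–Fischer door at `s = e^{ελ_b/2}μ_k > λ_k(β,1) = μ_k` (ONE: `μ_k > 0`); the cross terms are `≤ ελ_bλ₀/28` eventually. [cite: Luscher1983, §2] [cite: ReedSimonIV1978, Thm. XIII.1] -/
theorem innerNoIntruderOneOrbitAt_one {δ : ℝ → ℝ} (hδL : ∃ β1 : ℝ, ∀ β : ℝ, β1 ≤ β → δ β ≤ 1 / 2) :
    InnerNoIntruderOneOrbitAt 1 δ := by
  intro k ε hε
  obtain ⟨C1, B0, hONE⟩ := oneSiteLevels_proof k
  obtain ⟨β1, hδ1⟩ := hδL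
  obtain ⟨βs, hs⟩ := crossBound_eventually_small (L := 1) (m := 1 / 2) (by norm_num) hε
  have hτ0 : 0 < 1 / (2 * (|levelGap k| + |C1| + 2)) := by positivity
  refine ⟨max (max (max 1 B0) β1) (max βs (2 / (1 / (2 * (|levelGap k| + |C1| + 2))) ^ 3)), fun β hβ => ?_⟩
  have hβ1 : 1 ≤ β := (((le_max_left _ _).trans (le_max_left _ _)).trans (le_max_left _ _)).trans hβ
  have hβ0 : 0 < β := by linarith
  have hβB0 : B0 ≤ β := (((le_max_right _ _).trans (le_max_left _ _)).trans (le_max_left _ _)).trans hβ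
  have hβd : β1 ≤ β := ((le_max_right _ _).trans (le_max_left _ _)).trans hβ
  have hβs : βs ≤ β := ((le_max_left _ _).trans (le_max_right _ _)).trans hβ
  have hβτ : 2 / (1 / (2 * (|levelGap k| + |C1| + 2))) ^ 3 ≤ β := ((le_max_right _ _).trans (le_max_right _ _)).trans hβ
  intro G hGm hGb hGg hGs hGram
  -- scales at one site: `L = 1`, `m = 1/2`
  have hδ2 : δ β ≤ 1 / 2 := hδ1 β hβd
  have hLδ : ((1 : ℕ) : ℝ) * δ β < 2 := by rw [Nat.cast_one, one_mul]; linarith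
  have hLm : ((1 : ℕ) : ℝ) * (δ β + 1 / 2) < 2 := by rw [Nat.cast_one, one_mul]; linarith
  -- one-site data (`(1:ℝ)^3 * β = β`)
  have hB : ((1 : ℕ) : ℝ) ^ 3 * β = β := by rw [Nat.cast_one, one_pow, one_mul]
  obtain ⟨hμ0, -, hμk⟩ := hONE (((1 : ℕ) : ℝ) ^ 3 * β) (by rw [hB]; exact hβB0)
  have hlam0 : 0 < bareLambda (((1 : ℕ) : ℝ) ^ 3 * β) := bareLambda_pos' (by rw [hB]; exact hβ0)
  have hlamτ := bareLambda_cube_le (L := 1) hτ0 hβτ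
  obtain ⟨-, -, hy⟩ := smallness_of_le hlam0.le hlamτ
  have hμk' : Real.exp (-(levelGap k * bareLambda (((1 : ℕ) : ℝ) ^ 3 * β) + |C1| * bareLambda (((1 : ℕ) : ℝ) ^ 3 * β) ^ 2)) *
      levelValue su2Rep 1 (((1 : ℕ) : ℝ) ^ 3 * β) 0 ≤ levelValue su2Rep 1 (((1 : ℕ) : ℝ) ^ 3 * β) k := by
    refine le_trans (mul_le_mul_of_nonneg_right (Real.exp_le_exp.2 ?_) hμ0.le) hμk
    have := mul_le_mul_of_nonneg_right (le_abs_self C1) (sq_nonneg (bareLambda (((1 : ℕ) : ℝ) ^ 3 * β)))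
    linarith
  have hμk2 := half_le_of_exp_lower hy hμ0.le hμk'
  have hμkpos : 0 < levelValue su2Rep 1 (((1 : ℕ) : ℝ) ^ 3 * β) k := lt_of_lt_of_le (half_pos hμ0) hμk2
  have hΛ0 : levelValue su2Rep 1 β 0 = levelValue su2Rep 1 (((1 : ℕ) : ℝ) ^ 3 * β) 0 := by rw [hB]
  have hsc : 28 * crossBound 1 β (1 / 2) ≤ ε * bareLambda (((1 : ℕ) : ℝ) ^ 3 * β) * levelValue su2Rep 1 (((1 : ℕ) : ℝ) ^ 3 * β) 0 := by
    have h := (hs β hβs).trans (mul_le_mul_of_nonneg_left (levelValue_zero_ge_uniform (L := 1) hβ1) (by positivity))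
    rwa [hΛ0] at h
  -- the physical family `F = twistSum ∘ G`
  choose C hC using hGb
  have hφm : ∀ a : Fin (k + 1) → ℝ, Measurable fun U => ∑ i, a i * G i U := fun a => Finset.measurable_sum _ fun i _ => (hGm i).const_mul _
  have hφb : ∀ (a : Fin (k + 1) → ℝ) U, |∑ i, a i * G i U| ≤ ∑ i, |a i| * C i := fun a U =>
    (Finset.abs_sum_le_sum_abs _ _).trans (Finset.sum_le_sum fun i _ => by rw [abs_mul]; exact mul_le_mul_of_nonneg_left (hC i U) (abs_nonneg _))
  have hφg : ∀ (a : Fin (k + 1) → ℝ) (g : Site 3 1 → SU2) U, (∑ i, a i * G i (gaugeTransform g U)) = ∑ i, a i * G i U := fun a g U =>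
    Finset.sum_congr rfl fun i _ => by rw [hGg]
  have hφs : ∀ (a : Fin (k + 1) → ℝ) U, ∑ i, a i * G i U ≠ 0 → orbitDist U < δ β := fun a U h => by
    by_contra hlt
    exact h (Finset.sum_eq_zero fun i _ => by
      have : G i U = 0 := by by_contra hi; exact hlt (hGs i U hi)
      rw [this, mul_zero])
  set F : Fin (k + 1) → GaugeConfig 3 1 SU2 → ℝ := fun i => twistSum (G i) with hFdef
  have hF : ∀ i, IsPhys (F i) := fun i => isPhys_twistSum (hGm i) ⟨C i, hC i⟩ (hGg i)
  have hcomb : ∀ a : Fin (k + 1) → ℝ, (fun U => ∑ i, a i * F i U) = twistSum (fun U => ∑ i, a i * G i U) := fun a => by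
    rw [twistSum_sum_mul]
  have hl2 : ∀ a : Fin (k + 1) → ℝ, l2 (fun U => ∑ i, a i * F i U) (fun U => ∑ i, a i * F i U) =
      8 * l2 (fun U => ∑ i, a i * G i U) (fun U => ∑ i, a i * G i U) := fun a => by
    rw [hcomb a]; exact l2_twistSum (hφm a) (hφb a) hLδ (hφs a)
  have hq : ∀ a : Fin (k + 1) → ℝ, 8 * qform su2Rep β (fun U => ∑ i, a i * G i U) (fun U => ∑ i, a i * G i U) -
      56 * (crossBound 1 β (1 / 2) * l2 (fun U => ∑ i, a i * G i U) (fun U => ∑ i, a i * G i U)) ≤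
        qform su2Rep β (fun U => ∑ i, a i * F i U) (fun U => ∑ i, a i * F i U) := fun a => by
    rw [hcomb a]
    have h := abs_qform_twistSum_sub_le hβ0.le (hφm a) (hφb a) (by norm_num : (0 : ℝ) ≤ 1 / 2) hLm (hφs a)
    rw [abs_le] at h
    linarith [h.1]
  have hFpos : ∀ a : Fin (k + 1) → ℝ, a ≠ 0 → 0 < l2 (fun U => ∑ i, a i * F i U) (fun U => ∑ i, a i * F i U) := fun a ha => by
    rw [hl2 a]; linarith [hGram a ha]
  -- the Courant–Fischer door at `s = e^{ελ_b/2} μ_k > λ_k(β,1)`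
  set s : ℝ := Real.exp (ε / 2 * bareLambda (((1 : ℕ) : ℝ) ^ 3 * β)) * levelValue su2Rep 1 (((1 : ℕ) : ℝ) ^ 3 * β) k with hsdef
  have hks : levelValue su2Rep 1 β k < s := by
    rw [hsdef, ← hB]
    rw [hB]
    have h1 : 1 < Real.exp (ε / 2 * bareLambda (((1 : ℕ) : ℝ) ^ 3 * β)) := Real.one_lt_exp_iff.mpr (by positivity)
    have hpos' : 0 < levelValue su2Rep 1 β k := by rw [← hB]; exact hμkpos
    rw [hB] at h1 ⊢
    nlinarith
  obtain ⟨a, ha, hlt⟩ := exists_coeff_rayleigh_lt_of_levelValue_lt hks F hF hFpos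
  refine ⟨a, ha, ?_⟩
  rw [hl2 a] at hlt
  rw [hΛ0]
  exact oneSite_inner_endgame (l2_self_nonneg_lat _) hμ0.le hlam0.le hε.le hμk2 (hq a) hlt.le hsc

end Summit.QuantumFields.YangMills.Theorems.FemtoTransferGap

end
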